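import Literature.AlgebraicGeometry.ShimuraVarieties.UnitaryShimuraComplexRecordSystem
import Literature.AlgebraicGeometry.Motives.ProjectiveDescentProofs
import Literature.AlgebraicGeometry.Motives.GaloisDescentFunctor
import Literature.AlgebraicGeometry.Motives.AbelianVarietyBaseChangeTower
import HarnessLib

/-!
# Forms of the complex unitary Shimura tower: projectivity, separatedness, finite type and reducedness of the models
# ([Deligne 1971] Prop. 5.10, hypotheses of Lemme 5.10.1 (ii); [GortzWedhorn2020] Prop. 14.57)

Topic `AlgebraicGeometry/ShimuraVarieties`; namespace `Literature.AlgebraicGeometry.ShimuraVarieties.UnitaryCanonicalModel.ComplexRecordSystem`.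
THEOREMS ONLY (no definition, no instance, no named fact, no `sorry`); net Literature debt 0.  Cell `hodgecm-mathlib`
(D-0151), row I-6 `descentToIntersection_printed` — the crew's piece **D4-models** (lead A-p08 g2, CREW MAP v3 2026-08-28T06:54:37Z):
the regularity properties of the MODELS which the generic descent files (`GaloisDescentTwist` D1/D2, P3-gen, `GaloisDescentFunctor.Datum`
P4) take as hypotheses (`hproj`, `hsep`, `hlft`, `hred`, `hredL`, …).

Setting: the hDel datum `(L, H, τ, T, hT, K₀)`, a complex record system `Sc` (its levels `Sc.Mc_K` are smooth of relative dimension `2`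
and projective over `ℂ`, `Sc.smooth`, `Sc.projective`), a base field `F₀` inside `ℂ` (`[Algebra F₀ ℂ]`) and an `F₀`-FORM of the tower,
`M : C5.SmallLevel K₀ ⥤ SchemeOver F₀` with `e : M ⊗_{F₀} ℂ ≅ Sc.Mc` (`(M ⋙ bcFunctor F₀ ℂ) ≅ Sc.Mc`; the spelling
`Motives.baseChange F₀ ℂ` of the row's fact is the same functor by `rfl`), and an intermediate overfield `F₀ → F₁ → ℂ`
(`IsScalarTower F₀ F₁ ℂ`), `N := M ⊗_{F₀} F₁ = M ⋙ bcFunctor F₀ F₁` (the model over the compositum of [Deligne1971TravauxShimura]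
Prop. 5.10 proof, `GaloisDescentTwist.N`).  PROVED:

* `IsProjectiveOver.of_isoOver` — projectivity over a field is invariant under isomorphisms of `k`-schemes;
* `isProjectiveOver_form` — every level `M_K` of a form is PROJECTIVE over `F₀`: `M_K ⊗ ℂ ≅ Sc.Mc_K` is projective and projectivity
  DESCENDS along a field extension ([GortzWedhorn2020] Prop. 14.57, the tree's `IsProjectiveOver.baseChange_iff`); hence
  `isSeparated_form`, `locallyOfFiniteType_form`, `isProper_form`;
* `isReduced_bc_form` / `isReduced_form` — `M_K ⊗_{F₀} ℂ` (≅ `Sc.Mc_K`, smooth over `ℂ`, Stacks 056T) and `M_K` are REDUCED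
  (reducedness descends along the faithfully flat projection, EGA IV₂ 2.1.13);
* the same five properties for the compositum model `N_K = M_K ⊗_{F₀} F₁`: `isProjectiveOver_compositum`, `isSeparated_compositum`,
  `locallyOfFiniteType_compositum`, `isReduced_bc_compositum` (through the tower isomorphism `(M_K ⊗ F₁) ⊗_{F₁} ℂ ≅ M_K ⊗ ℂ`,
  [GortzWedhorn2020] Prop. 4.16, `bcFunctorTowerIso`) and `isReduced_compositum` — exactly the binders `hproj/hsep/hlft/hred/hredL` of
  the generic D3a/P4 files at the Shimura instantiation `Z := Sc.Mc`.

HC_CM is proved only modulo the 7 printed citations until rung 0 closes; this file discharges none of them by itself.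

## References
* [Deligne1971TravauxShimura] P. Deligne, *Travaux de Shimura*, Sém. Bourbaki 389 (1971), Prop. 5.10 and Lemme 5.10.1 (pp. 157–158)
  («effectivité … pour les schémas quasi-projectifs»).
* [GortzWedhorn2020] U. Görtz, T. Wedhorn, *Algebraic Geometry I* (2nd ed. 2020), Prop. 14.57 (descent of projectivity), Prop. 4.16
  (transitivity of base change), Thm. 14.83.
* [StacksProject] Tag 056T (smooth over a field ⇒ geometrically reduced); [GrothendieckDieudonne1965] EGA IV₂ Prop. 2.1.13.
-/

set_option autoImplicit false

noncomputable section

open Function NumberField CategoryTheory CategoryTheory.Limits Matrix AlgebraicGeometry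
open scoped Matrix ComplexOrder
open Literature.AlgebraicGeometry.Motives
open Literature.NumberTheory.Automorphic Literature.NumberTheory.Automorphic.UnitaryGroup
open Literature.NumberTheory.Automorphic.Liu2021.AppendixC (C5.OpenCompactSubgroup C5.SmallLevel)
open Literature.Geometry.ComplexHyperbolic Literature.Geometry.ComplexHyperbolic.BallModel

universe u

/-! ### §0. Projectivity over a field is invariant under isomorphisms of `k`-schemes -/

namespace Literature.AlgebraicGeometry.Motives

/-- `IsProjectiveOver` is invariant under isomorphisms of `k`-schemes: a closed immersion `S′ ↪ ℙⁿ_k` precomposed with an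
isomorphism `S ≅ S′` over `k` is a closed immersion. [cite: Hartshorne1977, Ch. II §4, definition before Thm. 4.9 (p. 103)] -/
theorem IsProjectiveOver.of_isoOver {k : Type u} [Field k] {S S' : SchemeOver k} (i : S ≅ S') (h : IsProjectiveOver S') :
    IsProjectiveOver S := by
  obtain ⟨n, κ, hκ⟩ := h
  haveI := hκ
  exact ⟨n, i.hom ≫ κ, inferInstanceAs (IsClosedImmersion (i.hom.left ≫ κ.left))⟩

end Literature.AlgebraicGeometry.Motives

namespace Literature.AlgebraicGeometry.ShimuraVarieties.UnitaryCanonicalModel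

namespace ComplexRecordSystem

open AbelianVariety (bcFunctor bcSpec bcFunctorTowerIso)

variable {L : Type} [Field L] [NumberField L] [IsCMField L] {H : Matrix (Fin 3) (Fin 3) L}
  {τ : L →+* ℂ} {T : GL (Fin 3) ℂ} {hT : formCongr (starRingEnd ℂ) T (H.map τ) = BallModel.J}
  {K₀ : C5.OpenCompactSubgroup ↥(finAdelic (↥(maximalRealSubfield L)) L (IsCMField.complexConj L) 3 H)}

/-! ### §1. The complex levels -/

/-- Every complex level `Sc.Mc_K` is reduced (smooth of relative dimension `2` over `ℂ`, Stacks 056T).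
[cite: StacksProject, Tag 056T (Varieties, Lemma 33.25.4)] -/
theorem isReduced_Mc_left (Sc : ComplexRecordSystem L H τ T hT K₀) (K : C5.SmallLevel K₀) : IsReduced (Sc.Mc.obj K).left := by
  haveI : SmoothOfRelativeDimension 2 (Sc.Mc.obj K).hom := Sc.smooth K
  haveI : Smooth (Sc.Mc.obj K).hom := SmoothOfRelativeDimension.smooth 2 _
  exact isReduced_of_smooth_over_field (Sc.Mc.obj K).hom

/-- Every complex level `Sc.Mc_K → Spec ℂ` is separated (projective). [cite: Hartshorne1977, Ch. II Thm. 4.9 (p. 103)] -/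
theorem isSeparated_Mc_hom (Sc : ComplexRecordSystem L H τ T hT K₀) (K : C5.SmallLevel K₀) : IsSeparated (Sc.Mc.obj K).hom :=
  (Sc.projective K).isProper.toIsSeparated

/-! ### §2. Forms over a subfield `F₀ ⊆ ℂ`: every level is projective, separated, of finite type, reduced -/

section Form

variable {F₀ : Type} [Field F₀] [Algebra F₀ ℂ]

/-- The complexified level `M_K ⊗_{F₀} ℂ` of a form is projective over `ℂ` (it is isomorphic to `Sc.Mc_K` over `ℂ`).
[cite: Hartshorne1977, Ch. II §4 (p. 103)] -/
theorem isProjectiveOver_bcFunctor_form (Sc : ComplexRecordSystem L H τ T hT K₀)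
    (M : C5.SmallLevel K₀ ⥤ SchemeOver F₀) (e : (M ⋙ bcFunctor F₀ ℂ) ≅ Sc.Mc) (K : C5.SmallLevel K₀) : IsProjectiveOver ((bcFunctor F₀ ℂ).obj (M.obj K)) :=
  IsProjectiveOver.of_isoOver (e.app K) (Sc.projective K)

/-- **Every level `M_K` of an `F₀`-form of the tower is projective over `F₀`**: `M_K ⊗_{F₀} ℂ ≅ Sc.Mc_K` is projective over `ℂ`, and
projectivity descends along the field extension `ℂ / F₀` ([GortzWedhorn2020] Prop. 14.57, `IsProjectiveOver.baseChange_iff`).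
[cite: GortzWedhorn2020, Prop. 14.57 (p. 571)] -/
theorem isProjectiveOver_form (Sc : ComplexRecordSystem L H τ T hT K₀)
    (M : C5.SmallLevel K₀ ⥤ SchemeOver F₀) (e : (M ⋙ bcFunctor F₀ ℂ) ≅ Sc.Mc) (K : C5.SmallLevel K₀) : IsProjectiveOver (M.obj K) :=
  (IsProjectiveOver.baseChange_iff (M.obj K) ℂ).1 (isProjectiveOver_bcFunctor_form Sc M e K)

/-- Every level of a form is proper over `F₀`. [cite: Hartshorne1977, Ch. II Thm. 4.9 (p. 103)] -/
theorem isProper_form (Sc : ComplexRecordSystem L H τ T hT K₀)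
    (M : C5.SmallLevel K₀ ⥤ SchemeOver F₀) (e : (M ⋙ bcFunctor F₀ ℂ) ≅ Sc.Mc) (K : C5.SmallLevel K₀) : IsProper (M.obj K).hom :=
  (isProjectiveOver_form Sc M e K).isProper

/-- Every level of a form is separated over `F₀`. [cite: Hartshorne1977, Ch. II Thm. 4.9 with Cor. 4.8 (p. 102–103)] -/
theorem isSeparated_form (Sc : ComplexRecordSystem L H τ T hT K₀)
    (M : C5.SmallLevel K₀ ⥤ SchemeOver F₀) (e : (M ⋙ bcFunctor F₀ ℂ) ≅ Sc.Mc) (K : C5.SmallLevel K₀) : IsSeparated (M.obj K).hom :=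
  (isProper_form Sc M e K).toIsSeparated

/-- Every level of a form is locally of finite type over `F₀`. [cite: Hartshorne1977, Ch. II Thm. 4.9 (p. 103)] -/
theorem locallyOfFiniteType_form (Sc : ComplexRecordSystem L H τ T hT K₀)
    (M : C5.SmallLevel K₀ ⥤ SchemeOver F₀) (e : (M ⋙ bcFunctor F₀ ℂ) ≅ Sc.Mc) (K : C5.SmallLevel K₀) : LocallyOfFiniteType (M.obj K).hom :=
  (isProper_form Sc M e K).toLocallyOfFiniteType

/-- The complexification `M_K ⊗_{F₀} ℂ` (the fibre product `GaloisDescent.bc ℂ M_K`) of a level of a form is reduced: it is isomorphic,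
as a scheme, to the smooth complex level `Sc.Mc_K`. [cite: StacksProject, Tag 056T] -/
theorem isReduced_bc_form (Sc : ComplexRecordSystem L H τ T hT K₀)
    (M : C5.SmallLevel K₀ ⥤ SchemeOver F₀) (e : (M ⋙ bcFunctor F₀ ℂ) ≅ Sc.Mc) (K : C5.SmallLevel K₀) : IsReduced (GaloisDescent.bc ℂ (M.obj K)) := by
  haveI : IsReduced (Sc.Mc.obj K).left := isReduced_Mc_left Sc K
  let i : GaloisDescent.bc ℂ (M.obj K) ≅ (Sc.Mc.obj K).left := (Over.forget _).mapIso (e.app K)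
  exact isReduced_of_isOpenImmersion i.hom

/-- **Every level `M_K` of a form is reduced** (reducedness of `M_K ⊗ ℂ` descends along the faithfully flat projection
`M_K ⊗ ℂ → M_K`, EGA IV₂ 2.1.13; the tree's `Literature.AlgebraicGeometry.Motives.isReduced_of_baseChange`).
[cite: GrothendieckDieudonne1965, Prop. 2.1.13] -/
theorem isReduced_form (Sc : ComplexRecordSystem L H τ T hT K₀)
    (M : C5.SmallLevel K₀ ⥤ SchemeOver F₀) (e : (M ⋙ bcFunctor F₀ ℂ) ≅ Sc.Mc) (K : C5.SmallLevel K₀) : IsReduced (M.obj K).left :=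
  Literature.AlgebraicGeometry.Motives.isReduced_of_baseChange ℂ (M.obj K) (isReduced_bc_form Sc M e K)

end Form

/-! ### §3. The model over a compositum `F₀ → F₁ → ℂ`: `N_K = M_K ⊗_{F₀} F₁` -/

section Compositum

variable {F₀ : Type} [Field F₀] [Algebra F₀ ℂ] (F₁ : Type) [Field F₁] [Algebra F₀ F₁]

/-- **The compositum model `N_K = M_K ⊗_{F₀} F₁` is projective over `F₁`** (base change of the projective `M_K`,
`IsProjectiveOver.baseChange_obj`). [cite: GortzWedhorn2020, Prop. 14.57 (p. 571)] [cite: Deligne1971TravauxShimura, Lemme 5.10.1 (ii) (p. 158)] -/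
theorem isProjectiveOver_compositum (Sc : ComplexRecordSystem L H τ T hT K₀)
    (M : C5.SmallLevel K₀ ⥤ SchemeOver F₀) (e : (M ⋙ bcFunctor F₀ ℂ) ≅ Sc.Mc) (K : C5.SmallLevel K₀) : IsProjectiveOver ((M ⋙ bcFunctor F₀ F₁).obj K) :=
  (isProjectiveOver_form Sc M e K).baseChange_obj F₁

/-- `N_K → Spec F₁` is proper. [cite: Hartshorne1977, Ch. II Thm. 4.9 (p. 103)] -/
theorem isProper_compositum (Sc : ComplexRecordSystem L H τ T hT K₀)
    (M : C5.SmallLevel K₀ ⥤ SchemeOver F₀) (e : (M ⋙ bcFunctor F₀ ℂ) ≅ Sc.Mc) (K : C5.SmallLevel K₀) : IsProper ((M ⋙ bcFunctor F₀ F₁).obj K).hom :=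
  (isProjectiveOver_compositum F₁ Sc M e K).isProper

/-- `N_K → Spec F₁` is separated (binder `hsep` of the generic descent files). [cite: Hartshorne1977, Ch. II Cor. 4.8 and Thm. 4.9 (p. 102–103)] -/
theorem isSeparated_compositum (Sc : ComplexRecordSystem L H τ T hT K₀)
    (M : C5.SmallLevel K₀ ⥤ SchemeOver F₀) (e : (M ⋙ bcFunctor F₀ ℂ) ≅ Sc.Mc) (K : C5.SmallLevel K₀) : IsSeparated ((M ⋙ bcFunctor F₀ F₁).obj K).hom :=
  (isProper_compositum F₁ Sc M e K).toIsSeparated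

/-- `N_K → Spec F₁` is locally of finite type (binder `hlft`). [cite: Hartshorne1977, Ch. II Thm. 4.9 (p. 103)] -/
theorem locallyOfFiniteType_compositum (Sc : ComplexRecordSystem L H τ T hT K₀)
    (M : C5.SmallLevel K₀ ⥤ SchemeOver F₀) (e : (M ⋙ bcFunctor F₀ ℂ) ≅ Sc.Mc) (K : C5.SmallLevel K₀) : LocallyOfFiniteType ((M ⋙ bcFunctor F₀ F₁).obj K).hom :=
  (isProper_compositum F₁ Sc M e K).toLocallyOfFiniteType

end Compositum

section CompositumComplex

variable {F₀ : Type} [Field F₀] [Algebra F₀ ℂ] (F₁ : Type) [Field F₁] [Algebra F₀ F₁] [Algebra F₁ ℂ]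
  [IsScalarTower F₀ F₁ ℂ]

/-- **`N_K ⊗_{F₁} ℂ` is reduced** (binder `hred`): through the tower isomorphism `(M_K ⊗_{F₀} F₁) ⊗_{F₁} ℂ ≅ M_K ⊗_{F₀} ℂ`
([GortzWedhorn2020] Prop. 4.16, `bcFunctorTowerIso`) and the form `e`, it is isomorphic as a scheme to the smooth complex level `Sc.Mc_K`.
[cite: GortzWedhorn2020, Prop. 4.16] [cite: StacksProject, Tag 056T] -/
theorem isReduced_bc_compositum (Sc : ComplexRecordSystem L H τ T hT K₀)
    (M : C5.SmallLevel K₀ ⥤ SchemeOver F₀) (e : (M ⋙ bcFunctor F₀ ℂ) ≅ Sc.Mc) (K : C5.SmallLevel K₀) : IsReduced (GaloisDescent.bc ℂ ((M ⋙ bcFunctor F₀ F₁).obj K)) := by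
  haveI : IsReduced (Sc.Mc.obj K).left := isReduced_Mc_left Sc K
  let i : GaloisDescent.bc ℂ ((M ⋙ bcFunctor F₀ F₁).obj K) ≅ (Sc.Mc.obj K).left :=
    (Over.forget _).mapIso (((bcFunctorTowerIso F₀ F₁ ℂ).app (M.obj K)) ≪≫ e.app K)
  exact isReduced_of_isOpenImmersion i.hom

/-- **`N_K` is reduced** (binder `hredL`; EGA IV₂ 2.1.13 along `N_K ⊗ ℂ → N_K`). [cite: GrothendieckDieudonne1965, Prop. 2.1.13] -/
theorem isReduced_compositum (Sc : ComplexRecordSystem L H τ T hT K₀)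
    (M : C5.SmallLevel K₀ ⥤ SchemeOver F₀) (e : (M ⋙ bcFunctor F₀ ℂ) ≅ Sc.Mc) (K : C5.SmallLevel K₀) : IsReduced ((M ⋙ bcFunctor F₀ F₁).obj K).left :=
  Literature.AlgebraicGeometry.Motives.isReduced_of_baseChange ℂ ((M ⋙ bcFunctor F₀ F₁).obj K) (isReduced_bc_compositum F₁ Sc M e K)

end CompositumComplex

end ComplexRecordSystem

end Literature.AlgebraicGeometry.ShimuraVarieties.UnitaryCanonicalModel

end
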